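import Literature.AlgebraicGeometry.Resolution.AlterationsStableModel
import HarnessLib

/-!
# De Jong 1996, 4.17 (vi) g): a pointed semi-stable model given on an open chart of the base

Topic: `Literature/AlgebraicGeometry/Resolution`. Property (vi) g) of de Jong 1996, 4.17 —

> "(vi) g) There exist a stable `n`-pointed curve `(𝒞, τ₁, …, τₙ)` over `Y`, a nonempty open
> subscheme `U ⊂ Y` and an isomorphism `β : 𝒞_U → X_U` mapping the section `τᵢ|_U` to the
> section `σᵢ|_U`." (p. 72)

— is rendered in `AlterationsStableModel.lean` as `DeJong1996.HasPointedSemiStableModel f g σ`,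
with `β` an isomorphism between the open subschemes `p⁻¹(U) ⊆ 𝒞` and `f⁻¹(U) ⊆ X`. In 4.17 the
isomorphism is produced over an open `U' ⊆ Y'` which is given as an abstract scheme with an open
immersion `U' → Y'` (an irreducible component of `U ×_{M_{g,n}} ℓM_{g,n}`, p. 72), and both
`𝒞_{U'}` and `X_{U'}` are given as abstract fibre products ("The smooth stable `n`-pointed curve
`(X_U, σ₁|_U, …, σₙ|_U) ×_U U'` extends to a stable `n`-pointed curve over `Y'`"). This file PROVES
the passage from such a chart to (vi) g) (`DeJong1996.HasPointedSemiStableModel.of_chart`): given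
an open immersion `j : V → Y` with `V` non-empty and a scheme `W → V` which is simultaneously the
pullback of the model `p : 𝒞 → Y` and of `f : X → Y` along `j` (two cartesian squares), with
sections `ρᵢ : V → W` lifting `τᵢ` and `σᵢ`, one gets the isomorphism `β : p⁻¹(U) ⥲ f⁻¹(U)` over
the open `U = j(V)` matching `τᵢ|_U` with `σᵢ|_U` — pure bookkeeping with the canonical
cartesian squares `p⁻¹(U) → U`, `f⁻¹(U) → U` (Mathlib's `isPullback_morphismRestrict`).

## References

* A. J. de Jong, *Smoothness, semi-stability and alterations*, Publ. Math. IHÉS 83 (1996), 4.17,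
  pp. 71–72. [DeJong1996]
-/

noncomputable section

open CategoryTheory CategoryTheory.Limits AlgebraicGeometry TopologicalSpace Topology

namespace Literature.AlgebraicGeometry.Resolution

universe u

namespace DeJong1996

/-- A cartesian square over an open immersion `j : V → Y` identifies its corner with the open
subscheme `p⁻¹(j(V))`: an isomorphism `W ≅ p⁻¹(U)`, `U = j(V)`, over `𝒞` and over `V ≅ U`.
[folklore] -/
theorem exists_iso_preimage_of_isPullback {C Y V W : Scheme.{u}} (p : C ⟶ Y) (j : V ⟶ Y)
    [IsOpenImmersion j] (r : W ⟶ V) (w : W ⟶ C) (h : IsPullback w r p j) :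
    ∃ φ : W ≅ (p ⁻¹ᵁ j.opensRange : C.Opens),
      φ.hom ≫ (p ⁻¹ᵁ j.opensRange).ι = w ∧
        φ.hom ≫ (p ∣_ j.opensRange) = r ≫ j.isoOpensRange.hom := by
  -- transport the square along `V ≅ U`
  have h' : IsPullback (r ≫ j.isoOpensRange.hom) w j.opensRange.ι p := by
    refine h.flip.of_iso (Iso.refl W) j.isoOpensRange (Iso.refl C) (Iso.refl Y) ?_ ?_ ?_ ?_
    · simp
    · simp
    · simp
    · simp
  refine ⟨h'.isoIsPullback _ _ (isPullback_morphismRestrict p j.opensRange), ?_, ?_⟩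
  · exact h'.isoIsPullback_hom_snd _ _ (isPullback_morphismRestrict p j.opensRange)
  · exact h'.isoIsPullback_hom_fst _ _ (isPullback_morphismRestrict p j.opensRange)

/-- **(vi) g) from a chart** (de Jong 1996, 4.17). Let `f : X → Y` over `g : Y → Spec k` with
sections `σᵢ`, and let `(p : 𝒞 → Y, τ)` be a pointed semi-stable curve with `𝒞` integral and
projective over `k`. Suppose that over some non-empty `V`, mapped into `Y` by an open immersion
`j`, a scheme `W → V` is at the same time the pullback of `p` and of `f` (cartesian squares
`w₁, r, p, j` and `w₂, r, f, j`) and carries sections `ρᵢ : V → W` with `ρᵢ ≫ w₁ = j ≫ τᵢ`,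
`ρᵢ ≫ w₂ = j ≫ σᵢ`. Then (vi) g) holds for `(f, σ)` with the model `(𝒞, τ)`: over the open
`U = j(V)` the isomorphism `β : p⁻¹(U) ≅ W ≅ f⁻¹(U)` maps `τᵢ|_U` to `σᵢ|_U`. (In 4.17: `V = U'`,
`W = (X_U, σ) ×_U U' ≅ 𝒞 ×_{Y'} U'`.) [cite: DeJong1996, 4.17, pp. 71–72] -/
theorem HasPointedSemiStableModel.of_chart {k : Type u} [Field k] {X Y C V W : Scheme.{u}}
    {f : X ⟶ Y} {g : Y ⟶ Spec (.of k)} {n : ℕ} {σ : Fin n → (Y ⟶ X)} {p : C ⟶ Y}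
    {τ : Fin n → (Y ⟶ C)} [IsIntegral C]
    (hproj : Literature.AlgebraicGeometry.Motives.IsProjectiveOver (Over.mk (p ≫ g)))
    (hC : IsPointedSemiStableCurve p τ) (j : V ⟶ Y) [IsOpenImmersion j] [Nonempty V]
    (r : W ⟶ V) (w₁ : W ⟶ C) (w₂ : W ⟶ X) (h₁ : IsPullback w₁ r p j) (h₂ : IsPullback w₂ r f j)
    (ρ : Fin n → (V ⟶ W)) (hρ₁ : ∀ i, ρ i ≫ w₁ = j ≫ τ i) (hρ₂ : ∀ i, ρ i ≫ w₂ = j ≫ σ i) :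
    HasPointedSemiStableModel f g σ := by
  set U : Y.Opens := j.opensRange
  obtain ⟨φC, hφC, hφCr⟩ := exists_iso_preimage_of_isPullback p j r w₁ h₁
  obtain ⟨φX, hφX, -⟩ := exists_iso_preimage_of_isPullback f j r w₂ h₂
  have hU : (U : Set Y).Nonempty := by
    obtain ⟨v⟩ := (inferInstance : Nonempty V)
    exact ⟨j v, ⟨v, rfl⟩⟩
  refine ⟨C, p, τ, U, φC.inv ≫ φX.hom, inferInstance, hproj, hC, hU, inferInstance, ?_, ?_⟩
  · -- `β` is a `Y`-morphism
    have e1 : φC.inv ≫ w₁ = (p ⁻¹ᵁ U).ι := by rw [Iso.inv_comp_eq, hφC]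
    rw [Category.assoc, reassoc_of% hφX, h₂.w, ← e1, Category.assoc, h₁.w]
  · intro i
    refine ⟨j.isoOpensRange.inv ≫ ρ i ≫ φC.hom, ?_, ?_⟩
    · rw [Category.assoc, Category.assoc, hφC, hρ₁, Scheme.Hom.isoOpensRange_inv_comp_assoc]
    · simp only [Category.assoc, Iso.hom_inv_id_assoc]
      rw [hφX, hρ₂, Scheme.Hom.isoOpensRange_inv_comp_assoc]

end DeJong1996

end Literature.AlgebraicGeometry.Resolution

end
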